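import Summits.CriticalPhenomena.PercolationContinuityZ3.Theorems.PercNearOneGluingNoHeavyLowerTailSahiCTCPara1CertsMM
import Summits.CriticalPhenomena.PercolationContinuityZ3.Theorems.PercNearOneGluingNoHeavyLowerTailSahiCTCPara1CertsLM
import Summits.CriticalPhenomena.PercolationContinuityZ3.Theorems.PercNearOneGluingNoHeavyLowerTailSahiCTCPara1CertsML
import Summits.CriticalPhenomena.PercolationContinuityZ3.Theorems.PercNearOneGluingNoHeavyLowerTailSahiCTCPara1CertsLL
import HarnessLib

/-!
# `NoHeavyLowerTail` (crux stmt-CriticalPhenomena-4575), P3 lane: **`PARA₁(K_X,K_Z) ∈ ℕ[r]` for EVERY pair of simplicial complexes** — the second form of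
# the threshold-certificate table closed by kernel-checked (reflective) step certificates (g9 §8.2 "PROVED: PARA₁")

Support file (seat `prim-l12-p3`, gen 19; `--supports stmt-CriticalPhenomena-4575`).  Memo `run/shared/lean/prim/prim-l12/FROM-prim-l12-p3-g19-CERTIFICATE-ROAD-G011.md`.
Nothing is asserted about the crux.

`coeff_PARA1V_nonneg`: strong induction on the ground finset; the step of each liveness case (`mm`, `lm`, `ml`, `ll`) is `…SahiCTCPara1Certs*`.  Axiom
closure: standard + the `native_decide` facts of the certificate files.
-/

namespace Summit.CriticalPhenomena.PercolationContinuityZ3.Theorems.SahiCTCForms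

open Finset MvPolynomial SahiCTCGenFun

variable {α : Type*} [DecidableEq α]

section main
variable [Fintype α]

/-- **`PARA₁(K_X,K_Z) ∈ ℕ[r]` for every ground finset and every pair of simplicial complexes** (down-sets containing `∅`): induction on `V`
with the certified step of the liveness case of the deleted vertex (all four cases; `PARA₁` is not symmetric). [this work] -/
theorem coeff_PARA1V_nonneg (V : Finset α) {KX KZ : Finset (Finset α)} (hKX : IsLowerSet (KX : Set (Finset α)))
    (hKZ : IsLowerSet (KZ : Set (Finset α))) (h0X : ∅ ∈ KX) (h0Z : ∅ ∈ KZ) : ∀ n, 0 ≤ (PARA1V V KX KZ).coeff n := by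
  induction V using Finset.strongInduction generalizing KX KZ with
  | H V ih =>
    rcases V.eq_empty_or_nonempty with hV | ⟨v, hv⟩
    · subst hV; intro n; rw [PARA1V_empty KX KZ, coeff_zero]
    · have hind := ih (V.erase v) (erase_ssubset hv) hKX hKZ h0X h0Z
      by_cases hvX : {v} ∈ KX <;> by_cases hvZ : {v} ∈ KZ
      · exact coeff_PARA1V_step_ll V KX KZ v hv hKX hKZ hvX hvZ hind
      · exact coeff_PARA1V_step_lm V KX KZ v hv hKX hKZ h0Z hvX hvZ hind
      · exact coeff_PARA1V_step_ml V KX KZ v hv hKX hKZ h0X hvX hvZ hind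
      · exact coeff_PARA1V_step_mm V KX KZ v hv hKX hKZ h0X h0Z hvX hvZ hind

/-- The same on the whole finite type. [this work] -/
theorem coeff_PARA1_nonneg {KX KZ : Finset (Finset α)} (hKX : IsLowerSet (KX : Set (Finset α))) (hKZ : IsLowerSet (KZ : Set (Finset α)))
    (h0X : ∅ ∈ KX) (h0Z : ∅ ∈ KZ) : ∀ n, 0 ≤ (PARA1V (univ : Finset α) KX KZ).coeff n :=
  coeff_PARA1V_nonneg univ hKX hKZ h0X h0Z

end main

end Summit.CriticalPhenomena.PercolationContinuityZ3.Theorems.SahiCTCForms
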